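import Literature.AlgebraicGeometry.Resolution.SncStrata
import HarnessLib

/-!
# The germ of a closed subset at a point, read off the primes of the local ring

Topic: `Literature/AlgebraicGeometry/Resolution`. Let `X` be a scheme, `v ∈ X`, and
`Spec 𝒪_{X,v} → X` the canonical morphism (Mathlib `Scheme.fromSpecStalk`): a topological
embedding onto the set `{η | η ⤳ v}` of generisations of `v` (Stacks 01J7), under which the
specialisation order of `X` corresponds to inclusion of primes of `𝒪_{X,v}`. For a closed
subset `Z ⊆ X` the *trace* `{q ∈ Spec 𝒪_{X,v} | η_q ∈ Z}` (`η_q` the image of `q`) is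
`V(I(Z)_v)`, the germ of `Z` at `v` seen inside the local ring; this file proves that it
determines `Z` on a neighbourhood of `v` when `X` is locally Noetherian. Everything is PROVED.

* `fromSpecStalk_specializes_iff_le` — `η_q ⤳ η_{q'} ↔ q ≤ q'`;
  `fromSpecStalk_specializes_iff_le_primeOfSpecializes` — `η_{P₀} ⤳ η ↔ P₀ ≤ 𝔭_η`;
  `existsUnique_fromSpecStalk_eq` — a generisation `η ⤳ v` is `η_q` for a unique `q`, namely
  `q = 𝔭_η = primeOfSpecializes _` (the two halves are `Motives.fromSpecStalk_comap_maximalIdeal`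
  and `primeOfSpecializes_fromSpecStalk` of `SncStrata.lean`; only the packaging is new here);
  `fromSpecStalk_mem_iff_stalkIdeal_le` — `η_q ∈ Z ↔ I(Z)_v ≤ q`.
* `exists_mem_maxPoints_specializes` — every point of a closed `Z` lies under a maximal point
  of `Z` (generic point of an irreducible component of `Z`; no Noetherian hypothesis: minimal
  primes of `I(Z)_w` exist by Zorn and are primes of maximal points,
  `exists_isMax_of_mem_minimalPrimes`).
* `exists_nhds_forall_maxPoints_specializes` — **cleaning neighbourhood** (locally Noetherian
  `X`): `v` has an open neighbourhood `U` such that every maximal point of `Z` specialising to a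
  point of `U` specialises to `v` (remove the closures of the finitely many nearby maximal
  points of `Z` not through `v`, Stacks 0BA8); hence
  `exists_nhds_mem_iff_exists_maxPoints_specializes` — **on `U`, `Z` is the union of the
  closures of its maximal points through `v`.**
* `exists_nhds_mem_iff_of_forall_fromSpecStalk` (any set `P` of primes) and
  `exists_nhds_inter_eq_of_forall_fromSpecStalk` (a `Finset`) — **the germ is read off the
  primes**: if the trace of `Z` on `Spec 𝒪_{X,v}` is `{q | ∃ P₀ ∈ P, P₀ ≤ q}` (i.e. `P` consists
  of primes over `I(Z)_v` and contains its minimal primes), then on a neighbourhood `U` of `v`,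
  `w ∈ Z ↔ ∃ P₀ ∈ P, η_{P₀} ⤳ w`: near `v`, `Z` is the union of the closures of the `η_{P₀}`.
  Corollaries: `exists_nhds_mem_iff_specializes_of_forall_fromSpecStalk` (one prime),
  `exists_nhds_inter_eq_of_forall_stalkIdeal_le` (hypothesis on `I(Z)_v` instead of the trace),
  `exists_nhds_mem_iff_exists_minimalPrimes_specializes` (`P` = the minimal primes of
  `I(Z)_v`), `exists_nhds_mem_iff_specializes_of_isPrime` (`I(Z)_v` prime: near `v`, `Z` is the
  closure of the single generisation `η_{I(Z)_v}`).

Proof of the main statement. If `η_{P₀} ⤳ w` then `w ∈ Z`, as `η_{P₀} ∈ Z` and `Z` is closed.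
Conversely let `U` be a cleaning neighbourhood and `w ∈ U ∩ Z`; pick a maximal point `η` of `Z`
with `η ⤳ w`; then `η ⤳ v`, so `η = η_q` for some `q`, and `η ∈ Z` gives `P₀ ≤ q` for some
`P₀ ∈ P`, i.e. `η_{P₀} ⤳ η ⤳ w`.

## Sources

* The Stacks Project, Tag 01J7 (= Schemes, Lemma 26.13.2: points of `Spec 𝒪_{X,x}` are the
  generisations of `x`), Tag 0BA8 (a locally Noetherian scheme has locally finitely many
  irreducible components). [StacksProject]
* A. Grothendieck, J. Dieudonné, *Éléments de géométrie algébrique* I (1960), Ch. I, 2.4.2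
  (`Spec 𝒪_{X,x} → X` is a homeomorphism onto the generisations of `x`) — classical form of the
  dictionary; folklore.

Not here: anything about the scheme structure of `Z` (only the underlying closed set is
considered), and the Noetherian-space form "`Z` has finitely many irreducible components"
(only the local finiteness of maximal points of `MaximalPoints.lean` is used). The statement
`fromSpecStalk_mem_iff_stalkIdeal_le` is also proved, from a chart, as
`fromSpecStalk_mem_iff_stalkIdeal_vanishingIdeal_le` in the import-heavy
`AlterationsNormalFormBlowupFormal.lean`; here it is a two-line consequence of `SncStrata.lean`.
-/

noncomputable section

open CategoryTheory AlgebraicGeometry TopologicalSpace Topology IsLocalRing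

universe u

namespace Literature.AlgebraicGeometry.Resolution

open Scheme.IdealSheafData

variable {X : Scheme.{u}}

/-! ## Specialisations among the generisations of a point -/

section Dictionary

variable {t : X}

/-- **Specialisations among generisations of `t` are inclusions of primes of `𝒪_{X,t}`**: for
`q, q' ∈ Spec 𝒪_{X,t}` with images `η_q, η_{q'} ∈ X`, `η_q ⤳ η_{q'} ↔ q ≤ q'`
(`Spec 𝒪_{X,t} → X` is a topological embedding, and on a prime spectrum `q ⤳ q' ↔ q ≤ q'`).
[cite: StacksProject, Tag 01J7] -/
theorem fromSpecStalk_specializes_iff_le (q q' : PrimeSpectrum (X.presheaf.stalk t)) :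
    X.fromSpecStalk t q ⤳ X.fromSpecStalk t q' ↔ q.asIdeal ≤ q'.asIdeal :=
  (X.fromSpecStalk t).isEmbedding.isInducing.specializes_iff.trans
    ((PrimeSpectrum.le_iff_specializes q q').symm.trans
      (PrimeSpectrum.asIdeal_le_asIdeal q q').symm)

/-- For a generisation `η ⤳ t` and `P₀ ∈ Spec 𝒪_{X,t}`: `η_{P₀} ⤳ η ↔ P₀ ≤ 𝔭_η`
(`η = η_{𝔭_η}`, `Motives.fromSpecStalk_comap_maximalIdeal`). [cite: StacksProject, Tag 01J7] -/
theorem fromSpecStalk_specializes_iff_le_primeOfSpecializes {η : X} (h : η ⤳ t)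
    (P₀ : PrimeSpectrum (X.presheaf.stalk t)) :
    X.fromSpecStalk t P₀ ⤳ η ↔ P₀.asIdeal ≤ primeOfSpecializes h := by
  have key := fromSpecStalk_specializes_iff_le P₀ ⟨primeOfSpecializes h, inferInstance⟩
  rwa [Literature.AlgebraicGeometry.Motives.fromSpecStalk_comap_maximalIdeal h] at key

/-- **Every generisation `η` of `t` is the image of exactly one point of `Spec 𝒪_{X,t}`**, namely
of `𝔭_η = primeOfSpecializes h` (`Motives.fromSpecStalk_comap_maximalIdeal`; uniqueness is the
injectivity of `Spec 𝒪_{X,t} → X`; the inverse direction `𝔭_{η_q} = q` is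
`primeOfSpecializes_fromSpecStalk`). [cite: StacksProject, Tag 01J7] -/
theorem existsUnique_fromSpecStalk_eq {η : X} (h : η ⤳ t) :
    ∃! q : PrimeSpectrum (X.presheaf.stalk t), X.fromSpecStalk t q = η := by
  refine ⟨⟨primeOfSpecializes h, inferInstance⟩,
    Literature.AlgebraicGeometry.Motives.fromSpecStalk_comap_maximalIdeal h, fun q hq => ?_⟩
  apply (X.fromSpecStalk t).isEmbedding.injective
  rw [hq, Literature.AlgebraicGeometry.Motives.fromSpecStalk_comap_maximalIdeal h]

/-- **The trace of a closed set on `Spec 𝒪_{X,t}` is `V(I(Z)_t)`**: `η_q ∈ Z ↔ I(Z)_t ≤ q`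
(`mem_iff_stalkIdeal_vanishingIdeal_le` and `𝔭_{η_q} = q`). [cite: StacksProject, Tag 01J7] -/
theorem fromSpecStalk_mem_iff_stalkIdeal_le (Z : Closeds X)
    (q : PrimeSpectrum (X.presheaf.stalk t)) :
    X.fromSpecStalk t q ∈ Z ↔ stalkIdeal (vanishingIdeal Z) t ≤ q.asIdeal := by
  have key := mem_iff_stalkIdeal_vanishingIdeal_le (Z := Z) (fromSpecStalk_specializes q)
  rwa [primeOfSpecializes_fromSpecStalk] at key

end Dictionary

/-! ## Maximal points above a point of a closed subset; cleaning neighbourhoods -/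

section MaxPoints

/-- **Every point `w` of a closed subset `Z` lies under a maximal point of `Z`** (the generic
point of an irreducible component of `Z` through `w`). No Noetherian hypothesis: a minimal prime
of `I(Z)_w ≤ 𝔪_w` exists by Zorn, and minimal primes of `I(Z)_w` are the primes of maximal
points of `Z` specialising to `w` (`exists_isMax_of_mem_minimalPrimes`). [folklore] -/
theorem exists_mem_maxPoints_specializes {Z : Set X} (hZ : IsClosed Z) {w : X} (hw : w ∈ Z) :
    ∃ η ∈ maxPoints Z, η ⤳ w := by
  have hle : stalkIdeal (vanishingIdeal (⟨Z, hZ⟩ : Closeds X)) w ≤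
      primeOfSpecializes (specializes_refl w) :=
    stalkIdeal_vanishingIdeal_le (Z := ⟨Z, hZ⟩) (specializes_refl w) hw
  obtain ⟨P, hP, -⟩ := Ideal.exists_minimalPrimes_le hle
  obtain ⟨η, h, hηZ, hmax, -⟩ := exists_isMax_of_mem_minimalPrimes hP
  exact ⟨η, ⟨hηZ, hmax⟩, h⟩

variable [IsLocallyNoetherian X]

/-- **Cleaning neighbourhood.** For a closed subset `Z` of a locally Noetherian scheme and a
point `v`, there is an open `U ∋ v` such that every maximal point of `Z` specialising to a point
of `U` specialises to `v`: take an open `U₀ ∋ v` meeting only finitely many maximal points of `Z`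
(Stacks 0BA8, `exists_isOpen_finite_maxPoints_inter`) and remove the closures of those not
specialising to `v`. [cite: StacksProject, Tag 0BA8] -/
theorem exists_nhds_forall_maxPoints_specializes {Z : Set X} (hZ : IsClosed Z) (v : X) :
    ∃ U : X.Opens, v ∈ U ∧ ∀ w ∈ U, ∀ η ∈ maxPoints Z, η ⤳ w → η ⤳ v := by
  obtain ⟨U₀, hU₀, hvU₀, hfin⟩ := exists_isOpen_finite_maxPoints_inter hZ v
  -- the finitely many nearby maximal points of `Z` not specialising to `v`
  set B : Set X := {η ∈ maxPoints Z ∩ U₀ | ¬ η ⤳ v}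
  have hBfin : B.Finite := hfin.subset fun η hη => hη.1
  refine ⟨⟨U₀ \ ⋃ η ∈ B, closure {η},
    hU₀.sdiff (hBfin.isClosed_biUnion fun η _ => isClosed_closure)⟩, ?_, ?_⟩
  · refine ⟨hvU₀, fun hv => ?_⟩
    simp only [Set.mem_iUnion] at hv
    obtain ⟨η, hηB, hηv⟩ := hv
    exact hηB.2 (specializes_iff_mem_closure.mpr hηv)
  · intro w hw η hη hηw
    have hw' : w ∈ U₀ \ ⋃ η ∈ B, closure {η} := hw
    have hηU₀ : η ∈ U₀ := hηw.mem_open hU₀ hw'.1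
    by_contra hηv
    apply hw'.2
    simp only [Set.mem_iUnion]
    exact ⟨η, ⟨⟨hη, hηU₀⟩, hηv⟩, specializes_iff_mem_closure.mp hηw⟩

/-- **Near `v`, a closed subset `Z` of a locally Noetherian scheme is the union of the closures
of its maximal points through `v`**: there is an open `U ∋ v` with
`w ∈ Z ↔ ∃ η ∈ maxPoints Z, η ⤳ v ∧ η ⤳ w` for all `w ∈ U`. [cite: StacksProject, Tag 0BA8] -/
theorem exists_nhds_mem_iff_exists_maxPoints_specializes {Z : Set X} (hZ : IsClosed Z) (v : X) :
    ∃ U : X.Opens, v ∈ U ∧ ∀ w ∈ U, (w ∈ Z ↔ ∃ η ∈ maxPoints Z, η ⤳ v ∧ η ⤳ w) := by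
  obtain ⟨U, hvU, hU⟩ := exists_nhds_forall_maxPoints_specializes hZ v
  refine ⟨U, hvU, fun w hw => ⟨fun hwZ => ?_, ?_⟩⟩
  · obtain ⟨η, hη, hηw⟩ := exists_mem_maxPoints_specializes hZ hwZ
    exact ⟨η, hη, hU w hw η hη hηw, hηw⟩
  · rintro ⟨η, hη, -, hηw⟩
    exact hηw.mem_closed hZ hη.1

end MaxPoints

/-! ## The germ of a closed subset in terms of primes of the local ring -/

section Germ

variable [IsLocallyNoetherian X]

/-- **The germ of a closed subset at `v` is read off the primes of `𝒪_{X,v}`** (set form). Let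
`Z` be closed in the locally Noetherian scheme `X`, `v ∈ X`, and `P` a set of primes of `𝒪_{X,v}`
such that a point `η_q` of `Spec 𝒪_{X,v}` (viewed in `X`) lies in `Z` iff `P₀ ≤ q` for some
`P₀ ∈ P`. Then on some open `U ∋ v`: `w ∈ Z ↔ ∃ P₀ ∈ P, η_{P₀} ⤳ w` — near `v`, `Z` is the
union of the closures of the generisations `η_{P₀}` of `v`. (`⇐`: `η_{P₀} ∈ Z` and `Z` is
closed. `⇒`: on a cleaning neighbourhood, `w ∈ Z` lies under a maximal point `η ⤳ v` of `Z`,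
`η = η_q` for some `q`, and `η ∈ Z` gives `P₀ ≤ q`, i.e. `η_{P₀} ⤳ η ⤳ w`.) [folklore] -/
theorem exists_nhds_mem_iff_of_forall_fromSpecStalk {Z : Set X} (hZ : IsClosed Z) (v : X)
    (P : Set (PrimeSpectrum (X.presheaf.stalk v)))
    (h : ∀ q : PrimeSpectrum (X.presheaf.stalk v),
      X.fromSpecStalk v q ∈ Z ↔ ∃ P₀ ∈ P, P₀.asIdeal ≤ q.asIdeal) :
    ∃ U : X.Opens, v ∈ U ∧ ∀ w ∈ U, (w ∈ Z ↔ ∃ P₀ ∈ P, X.fromSpecStalk v P₀ ⤳ w) := by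
  obtain ⟨U, hvU, hU⟩ := exists_nhds_forall_maxPoints_specializes hZ v
  refine ⟨U, hvU, fun w hw => ⟨fun hwZ => ?_, ?_⟩⟩
  · obtain ⟨η, hη, hηw⟩ := exists_mem_maxPoints_specializes hZ hwZ
    -- `η ⤳ v`, so `η = η_q` for a point `q` of `Spec 𝒪_{X,v}`
    obtain ⟨q, rfl⟩ : η ∈ Set.range (X.fromSpecStalk v) := by
      rw [Scheme.range_fromSpecStalk]
      exact hU w hw η hη hηw
    obtain ⟨P₀, hP₀, hle⟩ := (h q).mp hη.1
    exact ⟨P₀, hP₀, ((fromSpecStalk_specializes_iff_le P₀ q).mpr hle).trans hηw⟩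
  · rintro ⟨P₀, hP₀, hw⟩
    exact hw.mem_closed hZ ((h P₀).mpr ⟨P₀, hP₀, le_rfl⟩)

/-- **The germ of a closed subset at `v` is read off the primes of `𝒪_{X,v}`.** Let `Z` be
closed in the locally Noetherian scheme `X`, `v ∈ X`, and `P` a finite set of primes of
`𝒪_{X,v}` such that a point `η_q` of `Spec 𝒪_{X,v}` lies in `Z` iff `P₀ ≤ q` for some `P₀ ∈ P`
(equivalently: `P` consists of primes over `I(Z)_v` and contains the minimal ones). Then there
is an open `U ∋ v` on which `w ∈ Z ↔ ∃ P₀ ∈ P, η_{P₀} ⤳ w`: **near `v`, `Z` is the union of the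
closures of the generisations `η_{P₀}` (`P₀ ∈ P`) of `v`.** [folklore] -/
theorem exists_nhds_inter_eq_of_forall_fromSpecStalk (Z : Set X) (hZ : IsClosed Z) (v : X)
    (P : Finset (PrimeSpectrum (X.presheaf.stalk v)))
    (h : ∀ q : PrimeSpectrum (X.presheaf.stalk v),
      X.fromSpecStalk v q ∈ Z ↔ ∃ P₀ ∈ P, P₀.asIdeal ≤ q.asIdeal) :
    ∃ U : X.Opens, v ∈ U ∧ ∀ w ∈ U, (w ∈ Z ↔ ∃ P₀ ∈ P, X.fromSpecStalk v P₀ ⤳ w) := by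
  obtain ⟨U, hvU, hU⟩ := exists_nhds_mem_iff_of_forall_fromSpecStalk hZ v (P : Set _)
    (fun q => by simpa only [Finset.mem_coe] using h q)
  exact ⟨U, hvU, fun w hw => by simpa only [Finset.mem_coe] using hU w hw⟩

/-- **One prime.** If the trace of the closed subset `Z` on `Spec 𝒪_{X,v}` is `V(P₀)` for a
prime `P₀` (`η_q ∈ Z ↔ P₀ ≤ q`), then near `v`, `Z` is the closure of the generisation
`η_{P₀}`: on some open `U ∋ v`, `w ∈ Z ↔ η_{P₀} ⤳ w`. [folklore] -/
theorem exists_nhds_mem_iff_specializes_of_forall_fromSpecStalk {Z : Set X} (hZ : IsClosed Z)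
    (v : X) (P₀ : PrimeSpectrum (X.presheaf.stalk v))
    (h : ∀ q : PrimeSpectrum (X.presheaf.stalk v),
      X.fromSpecStalk v q ∈ Z ↔ P₀.asIdeal ≤ q.asIdeal) :
    ∃ U : X.Opens, v ∈ U ∧ ∀ w ∈ U, (w ∈ Z ↔ X.fromSpecStalk v P₀ ⤳ w) := by
  obtain ⟨U, hvU, hU⟩ := exists_nhds_mem_iff_of_forall_fromSpecStalk hZ v {P₀}
    (fun q => by simpa only [Set.mem_singleton_iff, exists_eq_left] using h q)
  exact ⟨U, hvU, fun w hw => by simpa only [Set.mem_singleton_iff, exists_eq_left] using hU w hw⟩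

/-- **Ideal form.** Let `Z` be closed in the locally Noetherian scheme `X`, `v ∈ X`, and `P` a
finite set of primes of `𝒪_{X,v}` such that a prime `q` lies over the germ `I(Z)_v` of the ideal
of `Z` iff `P₀ ≤ q` for some `P₀ ∈ P` (e.g. `P` = the minimal primes of `I(Z)_v`, or any finite
set of primes over `I(Z)_v` containing them). Then on some open `U ∋ v`,
`w ∈ Z ↔ ∃ P₀ ∈ P, η_{P₀} ⤳ w`. [folklore] -/
theorem exists_nhds_inter_eq_of_forall_stalkIdeal_le (Z : Closeds X) (v : X)
    (P : Finset (PrimeSpectrum (X.presheaf.stalk v)))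
    (h : ∀ q : PrimeSpectrum (X.presheaf.stalk v),
      stalkIdeal (vanishingIdeal Z) v ≤ q.asIdeal ↔ ∃ P₀ ∈ P, P₀.asIdeal ≤ q.asIdeal) :
    ∃ U : X.Opens, v ∈ U ∧ ∀ w ∈ U, (w ∈ Z ↔ ∃ P₀ ∈ P, X.fromSpecStalk v P₀ ⤳ w) := by
  obtain ⟨U, hvU, hU⟩ := exists_nhds_inter_eq_of_forall_fromSpecStalk (Z : Set X) Z.isClosed v P
    (fun q => (fromSpecStalk_mem_iff_stalkIdeal_le Z q).trans (h q))
  exact ⟨U, hvU, fun w hw => by simpa only [SetLike.mem_coe] using hU w hw⟩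

/-- **Near `v`, a closed `Z` is the union of the closures of the generisations `η_𝔭` of `v`
for `𝔭` the minimal primes of the germ `I(Z)_v` of its ideal** (`η_q ∈ Z ↔ I(Z)_v ≤ q`, and a
prime over `I(Z)_v` contains a minimal one). [folklore] -/
theorem exists_nhds_mem_iff_exists_minimalPrimes_specializes (Z : Closeds X) (v : X) :
    ∃ U : X.Opens, v ∈ U ∧ ∀ w ∈ U, (w ∈ Z ↔
      ∃ q : PrimeSpectrum (X.presheaf.stalk v),
        q.asIdeal ∈ (stalkIdeal (vanishingIdeal Z) v).minimalPrimes ∧ X.fromSpecStalk v q ⤳ w) := by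
  have hP : ∀ q : PrimeSpectrum (X.presheaf.stalk v), X.fromSpecStalk v q ∈ (Z : Set X) ↔
      ∃ P₀ ∈ {q : PrimeSpectrum (X.presheaf.stalk v) |
        q.asIdeal ∈ (stalkIdeal (vanishingIdeal Z) v).minimalPrimes}, P₀.asIdeal ≤ q.asIdeal := by
    intro q
    refine (fromSpecStalk_mem_iff_stalkIdeal_le Z q).trans ⟨fun hle => ?_, ?_⟩
    · obtain ⟨p, hp, hpq⟩ := Ideal.exists_minimalPrimes_le hle
      exact ⟨⟨p, hp.1.1⟩, hp, hpq⟩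
    · rintro ⟨P₀, hP₀, hle⟩
      exact (show P₀.asIdeal ∈ (stalkIdeal (vanishingIdeal Z) v).minimalPrimes from hP₀).1.2.trans
        hle
  obtain ⟨U, hvU, hU⟩ := exists_nhds_mem_iff_of_forall_fromSpecStalk Z.isClosed v _ hP
  exact ⟨U, hvU, fun w hw => by simpa only [Set.mem_setOf_eq, SetLike.mem_coe] using hU w hw⟩

/-- **Locally irreducible germ.** If the germ `I(Z)_v` of the ideal of the closed subset `Z` is
a prime `𝔭`, then near `v`, `Z` is the closure of the generisation `η_𝔭` of `v`: on some open
`U ∋ v`, `w ∈ Z ↔ η_𝔭 ⤳ w`. [folklore] -/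
theorem exists_nhds_mem_iff_specializes_of_isPrime (Z : Closeds X) (v : X)
    (hp : (stalkIdeal (vanishingIdeal Z) v).IsPrime) :
    ∃ U : X.Opens, v ∈ U ∧ ∀ w ∈ U,
      (w ∈ Z ↔ X.fromSpecStalk v ⟨stalkIdeal (vanishingIdeal Z) v, hp⟩ ⤳ w) := by
  obtain ⟨U, hvU, hU⟩ := exists_nhds_mem_iff_specializes_of_forall_fromSpecStalk Z.isClosed v
    ⟨stalkIdeal (vanishingIdeal Z) v, hp⟩ (fun q => fromSpecStalk_mem_iff_stalkIdeal_le Z q)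
  exact ⟨U, hvU, fun w hw => by simpa only [SetLike.mem_coe] using hU w hw⟩

end Germ

end Literature.AlgebraicGeometry.Resolution

end
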